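import Literature.NumberTheory.EllipticCurves.Kramer1981.LocalNormCokernel
import HarnessLib

/-!
# Kramer 1981, §2: the cokernel `E(F)/N E(K)` of the local norm at a RAMIFIED quadratic extension `K/F`
# of an UNRAMIFIED `2`-adic field `F` — Proposition 4 (supersingular reduction) and Proposition 5
# (ordinary good reduction), AS PRINTED

Source: K. Kramer, *Arithmetic of elliptic curves upon quadratic extension*, Trans. Amer. Math. Soc.
264 (1981) 121–135, doi:10.1090/s0002-9947-1981-0597871-8 [Kramer1981], §2 "The cokernel of the local
norm", printed pp. 126–127 (PUBLISHED, refereed; held text `paper:doi-10-1090-s0002-9947-1981-0597871-8`,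
locators `pNNNN Lk` of its materialised pages: p0007 = p. 126, p0008 = p. 127). TWO named facts
(`def … : Prop`, D-0014, nothing asserted), completing the `-- TODO(general form): Props. 4–5` of the
sibling module `Kramer1981/LocalNormCokernel.lean` (Props. 1, 2 (a), 3, 6), in the SAME vocabulary
(`KramerTunnell1982/UnramifiedNormIndex.lean`: `normSubgroup E K' σ = N E(K)`, `fixedSubgroup E K' σ =
E(K)^σ = E(F)`, the index `#(E(F)/N E(K)) = 2^{i(K/F)}` as `AddSubgroup.relIndex`; Mathlib's
`WeierstrassCurve.minimal`, `HasGoodReduction`, `reduction`; the tree's `QuadraticForms.hilbertSymbol F a b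
= (a, b)_F` and `maxUnramified F`). These two propositions are the residue-characteristic-`2` local norm
indices that the cell `bsd-f1-sign2` cites throughout (`F1Sign2/HondaSystemAtTwo.lean`,
`SignedSpanDefectAtTwo.lean`, `LocalKernelSymbolLawAtTwo.lean`, `LayerOneNormIndexFloorAtTwo.lean`,
`BlindSpotLocalLawsAtTwoAdditive.lean`, `DefiniteMod2WaldspurgerGaussianAtTwo.lean` (K): `i₂ = 2·[a₂ odd]`
for `K = ℚ(i)`), until now only as `[cite: Kramer1981, Prop. 4]` / `[…, Prop. 5]` tags with no tree
statement behind them.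

## The printed statements, verbatim (OCR of the held scan, displays re-set)

Setting [p0004 L6–L13, as in the sibling module]: "`F` is a finite extension of `ℚ_p` … `E` is an
elliptic curve defined over `F`, with an integral model whose discriminant `Δ` has minimal valuation.
We consider those `d ∈ F` for which `K = F(d^{1/2})` is a quadratic extension of `F`. The cokernel of
the local norm mapping `N : E(K) → E(F)` is a finite vector space over `F_2` whose dimension we denote
by `i(K/F)`." [p0007 L5–L6]: "We may assume that `K = F(d^{1/2})` is a ramified extension of `F`;
otherwise, `i(K/F) = 0`."
* **Proposition 4** [p0007 L16–L34]: "Assume that `F` is an unramified extension of `ℚ_2` and that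
  `K` over `F` is ramified. If `E` has supersingular reduction modulo `2` then
  `i(K/F) = 0` if `v(d)` is even, `i(K/F) = [F : ℚ_2]` if `v(d)` is odd.
  Moreover, `i(K/F)` is even or odd according to whether `(Δ, d)_F = ±1`."
  (proof, p0007 L36–L68: "Supersingular reduction forces `E(F)/E_1(F) ≅ E(k)` to have odd order. …
  Hence `i(K/F) = dim E_1(F)/N{E_1(K)}` … Since the formal group law (5) has height `2`, the
  coefficient `a_1` is divisible by the prime element `2` of `F` … `E_1(F)/N{E_1(K)}` is isomorphic to
  the cokernel of `tr`. If `v(d)` is even `tr` is surjective; hence `i(K/F) = 0`. If `v(d)` is odd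
  `tr` is the `0`-map; hence `i(K/F) = dim 𝔭_F/𝔭_F² = [F : ℚ_2]`. As for the parity of `i(K/F)` …
  `Δ` is in `−3·F^{*2}`. If `v(d)` is even, then `(Δ, d)_F = 1`. If `v(d)` is odd, then `(Δ, d)_F = 1`
  precisely when `−3` is a square in `F`, or equivalently `[F : ℚ_2]` is even.")
* **Proposition 5** [p0008 L21–L26]: "Assume that `F` is an unramified extension of `ℚ_2` and that
  `K` over `F` is ramified. If `E` has ordinary good reduction modulo `2` then `i(K/F)` is `2` or `1`
  according to whether `(Δ, d)_F = ±1`."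
  (proof, p0008 L28–L50: "By Lemma 1, `E_1(F)/N{E_1(K)}` is isomorphic to `U_F/N U_K` so has
  dimension `1`. Since `E` is ordinary modulo `2`, the reduction `Ē` already has a point of order `2`
  … Hence `E(k)/2E(k)` is `1` dimensional. We show below that the group in (6) is trivial if and only
  if `(Δ, d)_F = 1`, so that `i(K/F)` is as desired, using exact sequence (3).")
Not vendored here: Lemma 1 (p. 127, the commutative diagram for `P(z) = 1 + z − a_2 z²`; a tool of
the proof, not a statement about `i(K/F)`); Prop. 2 (b) (display illegible in the held scan, as recorded
in the sibling module); Theorems 1–2, Prop. 7 (global; `TwoSelmerRankQuadraticParity.lean` /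
`BSDSelmerParity…`).

## Transcription (tree vocabulary; nothing re-declared)

* "`F` is an unramified extension of `ℚ_2`": `F` a Mathlib nonarchimedean local field of
  characteristic `0` (`[IsNonarchimedeanLocalField F] [CharZero F]`, as in the sibling module) in which
  `2` is a PRIME ELEMENT of the valuation ring — `Irreducible (2 : 𝒪[F])` (Kramer's own use: "the prime
  element `2` of `F`", p0007 L42–L43). In the discrete valuation ring `𝒪[F]` this says `v_F(2) = 1`:
  the residue characteristic is `2` (a prime element is not a unit) and `e(F/ℚ_2) = 1`, i.e. `F/ℚ_2` is
  (finite and) unramified; conversely every finite unramified `F/ℚ_2` has `2` as a uniformizer. Then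
  `[F : ℚ_2] = f(F/ℚ_2)` and `#k = 2^{[F : ℚ_2]}` for the residue field `k = IsLocalRing.ResidueField 𝒪[F]`,
  so the printed value "`i(K/F) = [F : ℚ_2]`" is typed as "the index `2^{i(K/F)}` equals `#k`"
  (`Nat.card (IsLocalRing.ResidueField 𝒪[F])`).
* "`K` over `F` is ramified", "`K = F(d^{1/2})`", `σ`, "`i(K/F) = i`": exactly as in the sibling module
  — `K'` an intermediate field of `F̄/F` with `[K' : F] = 2` and `¬ K' ≤ maxUnramified F`, `d : F` not a
  square with a square root `x ∈ K'`, `σ ≠ 1` in `Aut(K'/F)`, and "`i(K/F) = i`" = "the index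
  `(normSubgroup E K' σ).relIndex (fixedSubgroup E K' σ)` is `2^i`".
* "`v(d)` is even / odd": `F` being unramified over `ℚ_2`, `2` is a uniformizer, so every non-zero `d`
  is `u · 2^n` with `u ∈ 𝒪[F]^×`, `n = v(d) ∈ ℤ`; typed as a clause `∀ (n : ℤ) (u : 𝒪[F]ˣ),
  d = u · 2^n → (Even n → …) ∧ (Odd n → …)` (for the `d` of the statement exactly one `n` occurs).
* "`E` has supersingular reduction modulo `2`" / "ordinary good reduction modulo `2`": the minimal model
  has good reduction (`(E.minimal 𝒪[F]).HasGoodReduction 𝒪[F]`) and its reduction `Ē` over `k` has NO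
  point of order `2`, `#Ē(k)[2] = 1` (supersingular in characteristic `2` ⟺ `Ē[2](k̄) = 0`; Kramer:
  "supersingular reduction forces `E(k)` to have odd order"), resp. has a point of order `2`,
  `#Ē(k)[2] = 2` (ordinary ⟺ `Ē[2](k̄) ≅ ℤ/2`, whose non-zero point is Galois-fixed hence `k`-rational;
  Kramer: "since `E` is ordinary modulo `2`, the reduction `Ē` already has a point of order `2`") — the
  same `AddSubgroup.torsionBy … (2 : ℤ)` carrier as Prop. 3 of the sibling module.
* "`(Δ, d)_F = ±1`": `QuadraticForms.hilbertSymbol F (E.minimal 𝒪[F]).Δ d = 1 / = -1` (`Δ` of Mathlib's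
  minimal model; the symbol is invariant under `Δ ↦ u^{12} Δ`); "`i(K/F)` is `2` or `1`" = "the index is
  `4` resp. `2`"; "`i(K/F)` even or odd according to `(Δ, d)_F = ±1`" = `∃ i, index = 2^i ∧ (Even i ↔
  (Δ, d)_F = 1)`, the shape used for Prop. 3.

Faithfulness: binders verbatim; weaker than print only in fixing `F` to Mathlib's local fields (as the
sibling module). presearch: Kramer 1981 Props. 4–5 → [corpus:paper:doi-10-1090-s0002-9947-1981-0597871-8
p. 7–8] the printed statements (held, quoted above); tree: `lean search 'Kramer1981, (§2 )?Prop\. [45]'`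
→ 57 citation tags under `Summits/BirchSwinnertonDyer/…/F1Sign2/` and `…/Theorems/ByReductionTypeAtTwo…`,
no statement; Mathlib: none (no local norm index of an elliptic curve). Typer -ty g21 (cell
bsd-f1-sign2), 2026-08-30.
-/

noncomputable section

open ValuativeRel Field
open Literature.NumberTheory.GaloisRepresentations.IsNonarchimedeanLocalField
open Literature.NumberTheory.DiophantineGeometry
open Literature.NumberTheory.EllipticCurves.KramerTunnell1982
open Literature.NumberTheory.QuadraticForms

namespace Literature.NumberTheory.EllipticCurves.Kramer1981

section Fact

open scoped Classical

/-- **Kramer 1981, Proposition 4** (Trans. AMS 264, §2, p. 126; verbatim in the module docstring), the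
RAMIFIED quadratic extensions of an UNRAMIFIED `2`-adic field, SUPERSINGULAR reduction: "Assume that
`F` is an unramified extension of `ℚ_2` and that `K` over `F` is ramified. If `E` has supersingular
reduction modulo `2` then `i(K/F) = 0` if `v(d)` is even, `= [F : ℚ_2]` if `v(d)` is odd. Moreover,
`i(K/F)` is even or odd according to whether `(Δ, d)_F = ±1`." Typed (dictionary in the module
docstring): for `F` (char. `0`) with `2` a prime element of `𝒪[F]`, `E/F` elliptic whose minimal model
has good reduction with `#Ē(k)[2] = 1`, `K' = F(√d)` quadratic and NOT inside the maximal unramified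
extension, `σ ≠ 1`: writing `d = u · 2^n` (`u` a unit, `n = v(d)`), the index `#(E(K')^σ / N E(K'))`
is `1` if `n` is even and `#k` (`= 2^{[F : ℚ_2]}`) if `n` is odd; and, writing the index as `2^i`, `i`
is even iff `(Δ, d)_F = 1`. For `F = ℚ_2`, `K = ℚ_2(i)` (`d = −1`, `v(d) = 0` even): `i(K/F) = 0` —
the supersingular half of the cell's `i₂ = 2·[a₂ odd]` at the Gaussian field. Named fact (PUBLISHED);
nothing asserted; users take `(h : prop4_ramifiedSupersingularNormIndexAtTwo)`.
[cite: Kramer1981, §2 Prop. 4 (p. 126)] -/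
def prop4_ramifiedSupersingularNormIndexAtTwo : Prop :=
  ∀ (F : Type) [Field F] [ValuativeRel F] [TopologicalSpace F] [IsNonarchimedeanLocalField F]
    [CharZero F] (_h2 : Irreducible (2 : 𝒪[F]))
    (E : WeierstrassCurve F) [E.IsElliptic] (_hgood : (E.minimal 𝒪[F]).HasGoodReduction 𝒪[F])
    (_hss : Nat.card (AddSubgroup.torsionBy
      ((E.minimal 𝒪[F]).reduction 𝒪[F]).toAffine.Point (2 : ℤ)) = 1)
    (K' : IntermediateField F (AlgebraicClosure F)) (_hK : Module.finrank F K' = 2)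
    (_hram : ¬ K' ≤ maxUnramified F)
    (σ : K' ≃ₐ[F] K') (_hσ : σ ≠ 1) (d : F) (_hd : ¬ IsSquare d) (x : K')
    (_hx : x ^ 2 = algebraMap F K' d),
    (∀ (n : ℤ) (u : (𝒪[F])ˣ), d = ((u : 𝒪[F]) : F) * (2 : F) ^ n →
        (Even n → (normSubgroup E K' σ).relIndex (fixedSubgroup E K' σ) = 1) ∧
          (Odd n → (normSubgroup E K' σ).relIndex (fixedSubgroup E K' σ) =
            Nat.card (IsLocalRing.ResidueField 𝒪[F]))) ∧
      ∃ i : ℕ, (normSubgroup E K' σ).relIndex (fixedSubgroup E K' σ) = 2 ^ i ∧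
        (Even i ↔ hilbertSymbol F (E.minimal 𝒪[F]).Δ d = 1)

/-- **Kramer 1981, Proposition 5** (Trans. AMS 264, §2, p. 127; verbatim in the module docstring), the
RAMIFIED quadratic extensions of an UNRAMIFIED `2`-adic field, ORDINARY good reduction: "Assume that
`F` is an unramified extension of `ℚ_2` and that `K` over `F` is ramified. If `E` has ordinary good
reduction modulo `2` then `i(K/F)` is `2` or `1` according to whether `(Δ, d)_F = ±1`." Typed: for
`F` (char. `0`) with `2` a prime element of `𝒪[F]`, `E/F` elliptic whose minimal model has good
reduction with `#Ē(k)[2] = 2`, `K' = F(√d)` quadratic and NOT inside the maximal unramified extension,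
`σ ≠ 1`: the index `#(E(K')^σ / N E(K'))` is `4` if `(Δ, d)_F = 1` and `2` if `(Δ, d)_F = −1`. For
`F = ℚ_2`, `K = ℚ_2(i)` and `Δ ≡ 1 (mod 4)` (so `(Δ, −1)_2 = +1`): `i(K/F) = 2` — the ordinary half of
the cell's `i₂ = 2·[a₂ odd]` at the Gaussian field. Named fact (PUBLISHED); nothing asserted; users take
`(h : prop5_ramifiedOrdinaryNormIndexAtTwo)`. [cite: Kramer1981, §2 Prop. 5 (p. 127)] -/
def prop5_ramifiedOrdinaryNormIndexAtTwo : Prop :=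
  ∀ (F : Type) [Field F] [ValuativeRel F] [TopologicalSpace F] [IsNonarchimedeanLocalField F]
    [CharZero F] (_h2 : Irreducible (2 : 𝒪[F]))
    (E : WeierstrassCurve F) [E.IsElliptic] (_hgood : (E.minimal 𝒪[F]).HasGoodReduction 𝒪[F])
    (_hord : Nat.card (AddSubgroup.torsionBy
      ((E.minimal 𝒪[F]).reduction 𝒪[F]).toAffine.Point (2 : ℤ)) = 2)
    (K' : IntermediateField F (AlgebraicClosure F)) (_hK : Module.finrank F K' = 2)
    (_hram : ¬ K' ≤ maxUnramified F)
    (σ : K' ≃ₐ[F] K') (_hσ : σ ≠ 1) (d : F) (_hd : ¬ IsSquare d) (x : K')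
    (_hx : x ^ 2 = algebraMap F K' d),
    (hilbertSymbol F (E.minimal 𝒪[F]).Δ d = 1 →
        (normSubgroup E K' σ).relIndex (fixedSubgroup E K' σ) = 4) ∧
      (hilbertSymbol F (E.minimal 𝒪[F]).Δ d = -1 →
        (normSubgroup E K' σ).relIndex (fixedSubgroup E K' σ) = 2)

/-! ### API (proved): consumer shapes (unfolding) -/

/-- **Consumable form of Prop. 4, first clause**: under the fact, at a ramified quadratic `K' = F(√d)`
of an unramified `2`-adic `F` with `v(d)` EVEN (e.g. `F = ℚ_2`, `d = −1`: the Gaussian field) and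
supersingular reduction, every `σ`-fixed point of `E(K')` is a norm — `i(K/F) = 0`
(Mathlib `AddSubgroup.relIndex_eq_one`). [cite: Kramer1981, §2 Prop. 4 (p. 126), case v(d) even (unfolding)] -/
theorem prop4_ramifiedSupersingularNormIndexAtTwo.fixed_le_norm_of_even
    (h : prop4_ramifiedSupersingularNormIndexAtTwo)
    (F : Type) [Field F] [ValuativeRel F] [TopologicalSpace F] [IsNonarchimedeanLocalField F]
    [CharZero F] (h2 : Irreducible (2 : 𝒪[F]))
    (E : WeierstrassCurve F) [E.IsElliptic] (hgood : (E.minimal 𝒪[F]).HasGoodReduction 𝒪[F])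
    (hss : Nat.card (AddSubgroup.torsionBy
      ((E.minimal 𝒪[F]).reduction 𝒪[F]).toAffine.Point (2 : ℤ)) = 1)
    (K' : IntermediateField F (AlgebraicClosure F)) (hK : Module.finrank F K' = 2)
    (hram : ¬ K' ≤ maxUnramified F) (σ : K' ≃ₐ[F] K') (hσ : σ ≠ 1) (d : F) (hd : ¬ IsSquare d)
    (x : K') (hx : x ^ 2 = algebraMap F K' d)
    (n : ℤ) (u : (𝒪[F])ˣ) (hdn : d = ((u : 𝒪[F]) : F) * (2 : F) ^ n) (hn : Even n) :
    fixedSubgroup E K' σ ≤ normSubgroup E K' σ :=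
  AddSubgroup.relIndex_eq_one.mp
    (((h F h2 E hgood hss K' hK hram σ hσ d hd x hx).1 n u hdn).1 hn)

/-- **Consumable form of Prop. 5**: under the fact, at a ramified quadratic extension of an unramified
`2`-adic field with ORDINARY good reduction the local norm is NEVER surjective onto `E(F)` — the index is
`2` or `4`, so it is even (`i(K/F) ≥ 1`), whatever the sign of `(Δ, d)_F ∈ {±1}` (the tree's
`hilbertSymbol` takes the values `±1` on non-zero arguments; the dichotomy is supplied as a hypothesis to
keep this an unfolding). [cite: Kramer1981, §2 Prop. 5 (p. 127) (unfolding)] -/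
theorem prop5_ramifiedOrdinaryNormIndexAtTwo.two_dvd_relIndex
    (h : prop5_ramifiedOrdinaryNormIndexAtTwo)
    (F : Type) [Field F] [ValuativeRel F] [TopologicalSpace F] [IsNonarchimedeanLocalField F]
    [CharZero F] (h2 : Irreducible (2 : 𝒪[F]))
    (E : WeierstrassCurve F) [E.IsElliptic] (hgood : (E.minimal 𝒪[F]).HasGoodReduction 𝒪[F])
    (hord : Nat.card (AddSubgroup.torsionBy
      ((E.minimal 𝒪[F]).reduction 𝒪[F]).toAffine.Point (2 : ℤ)) = 2)
    (K' : IntermediateField F (AlgebraicClosure F)) (hK : Module.finrank F K' = 2)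
    (hram : ¬ K' ≤ maxUnramified F) (σ : K' ≃ₐ[F] K') (hσ : σ ≠ 1) (d : F) (hd : ¬ IsSquare d)
    (x : K') (hx : x ^ 2 = algebraMap F K' d)
    (hsym : hilbertSymbol F (E.minimal 𝒪[F]).Δ d = 1 ∨ hilbertSymbol F (E.minimal 𝒪[F]).Δ d = -1) :
    2 ∣ (normSubgroup E K' σ).relIndex (fixedSubgroup E K' σ) := by
  obtain ⟨h1, hm1⟩ := h F h2 E hgood hord K' hK hram σ hσ d hd x hx
  rcases hsym with hs | hs
  · rw [h1 hs]; norm_num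
  · rw [hm1 hs]

end Fact

end Literature.NumberTheory.EllipticCurves.Kramer1981

end
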